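import Mathlib
import Literature.Combinatorics.Enumerative.SymplecticCharacterPrincipal
import HarnessLib

/-!
# IP12's symplectic character as a polynomial: Weyl's character formula for the bialternant

Topic `Literature/Combinatorics/Enumerative`. Ikhlef–Ponsaing (J. Stat. Phys. 149 (2012),
arXiv:1202.5476) Def. 3.4 define `χ_L(u_1,…,u_L) = det[u_i^{μ_k} - u_i^{-μ_k}] / det[u_i^{δ_k} - u_i^{-δ_k}]`
(`δ_k = k+1`, `μ_k = ipMu k`, columns indexed by `k = L - j`). `SymplecticCharacterPrincipal` treats this
as a real function and computes its homogeneous value through the principal specialisation. For the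
sum rule (IP12 Prop. 3.4) and the recursion (26) one needs `χ_L` as an honest (Laurent) POLYNOMIAL with
its symmetries; this file provides Weyl's character formula in the form

  `det[E_{μ_k-1}(x_i)] = det[E_k(x_i)] · S_L(x)`,  `x_i = u_i + u_i⁻¹`,

where `E_n` are the Chebyshev polynomials with `(u - u⁻¹) E_n(u + u⁻¹) = u^{n+1} - u^{-(n+1)}` (so that
dividing the `i`-th rows of both alternants by `u_i - u_i⁻¹` turns them into `det[E_{μ_k-1}(x_i)]` and
the Vandermonde `det[E_k(x_i)] = ∏_{i<j} (x_j - x_i)`), and `S_L ∈ K[x_u, …, x_{u+L-1}]` is a symmetric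
POLYNOMIAL (the window of variables starts at an arbitrary index `u`, as needed by the recursions of
the percolation development, which peel off two variables at a time).

* `chebE`, `chebE_monic_natDegree`, `chebE_eval`, `chebE_map`, `spE_eq_chebE`;
* `xAlt K u L e = det[E_{e_k-1}(x_{u+i})]`, `xAlt_succ` (Vandermonde), `X_sub_X_dvd_xAlt`,
  `prime_X_sub_X`, `isRelPrime_X_sub_X`, **`xAlt_succ_dvd_xAlt`** (the Vandermonde divides every
  alternant: distinct linear forms are non-associated primes of the UFD `K[x]`);
* **`spS K u L`** with `xAlt_ipMu_eq : A_μ = V · S_L`, `eq_spS_of_mul_eq`, `map_spS` (change of field),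
  `rename_swap_spS` (symmetry), `degreeOf_spS_eq_zero` (only window variables), `spS_ne_zero`;
* **`spChar_eq_eval_spS`**: IP12's `χ_L(u) = S_L(u_1 + u_1⁻¹, …)` wherever the Weyl denominator is not
  zero, and **`eval_two_spS_real` / `eval_two_spS`**: `S_L(2, …, 2) = ipSpDim L` — the homogeneous value
  `χ_L(1, …, 1)` used in IP12 Prop. 4.7, now as the value of a polynomial (from
  `tendsto_spChar_principal` by continuity);
* `xAlt_succ_eq_sum`, `xAltMat_submatrix_last`, `degreeOf_xAlt_le`: the Laplace expansion along the
  first variable (for the branching rule `[x_u^{top}] S_L = S_{L-1}(x_{u+1}, …)` downstream).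

## References

* Y. Ikhlef, A. K. Ponsaing, *Finite-size left-passage probability in percolation*, J. Stat. Phys.
  149 (2012) 10–36, arXiv:1202.5476, Def. 3.4, (26), Props. 3.4 and 4.7. [IkhlefPonsaing2012]
* W. Fulton, J. Harris, Representation Theory, GTM 129, Springer 1991, §24.2 (Weyl character formula
  for `Sp(2n)`). [FultonHarris1991]
-/

namespace Literature.Combinatorics.Enumerative

open Finset Matrix Polynomial

/-! ### Chebyshev polynomials of the second kind over any commutative ring -/

section ChebE

variable (R : Type*) [CommRing R]

/-- `E_0 = 1`, `E_1 = X`, `E_{n+2} = X E_{n+1} - E_n`: the polynomials with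
`(u - u⁻¹) E_n(u + u⁻¹) = u^{n+1} - u^{-(n+1)}` (the `spE` of `SymplecticCharacterPrincipal` over an
arbitrary commutative ring). [folklore] -/
noncomputable def chebE : ℕ → R[X]
  | 0 => 1
  | 1 => X
  | n + 2 => X * chebE (n + 1) - chebE n

/-- `E_0 = 1`. [folklore] -/
theorem chebE_zero : chebE R 0 = 1 := rfl

/-- `E_1 = X`. [folklore] -/
theorem chebE_one : chebE R 1 = X := rfl

/-- The three-term recurrence. [folklore] -/
theorem chebE_add_two (n : ℕ) : chebE R (n + 2) = X * chebE R (n + 1) - chebE R n := rfl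

variable {R}

/-- `E_n` is monic of degree `n`. [folklore] -/
theorem chebE_monic_natDegree [Nontrivial R] : ∀ n, (chebE R n).Monic ∧ (chebE R n).natDegree = n
  | 0 => ⟨monic_one, natDegree_one⟩
  | 1 => ⟨monic_X, natDegree_X⟩
  | n + 2 => by
    obtain ⟨hm1, hd1⟩ := chebE_monic_natDegree (n + 1)
    obtain ⟨hm0, hd0⟩ := chebE_monic_natDegree n
    have hmX : (X * chebE R (n + 1)).Monic := monic_X.mul hm1
    have hdX : (X * chebE R (n + 1)).natDegree = n + 2 := by
      rw [monic_X.natDegree_mul hm1, natDegree_X, hd1]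
      omega
    have hlt : (chebE R n).degree < (X * chebE R (n + 1)).degree := by
      rw [degree_eq_natDegree hm0.ne_zero, degree_eq_natDegree hmX.ne_zero, hd0, hdX]
      exact_mod_cast (by omega : n < n + 2)
    have hlt' : (chebE R n).natDegree < (X * chebE R (n + 1)).natDegree := by rw [hd0, hdX]; omega
    rw [chebE_add_two]
    exact ⟨hmX.sub_of_left hlt, by rw [natDegree_sub_eq_left_of_natDegree_lt hlt', hdX]⟩

/-- `E_n` under a ring homomorphism. [folklore] -/
theorem chebE_map {S : Type*} [CommRing S] (f : R →+* S) : ∀ n, (chebE R n).map f = chebE S n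
  | 0 => by simp [chebE_zero]
  | 1 => by simp [chebE_one]
  | n + 2 => by
    rw [chebE_add_two, chebE_add_two, Polynomial.map_sub, Polynomial.map_mul, map_X, chebE_map f (n + 1),
      chebE_map f n]

/-- **The defining identity** in any field: `(u - u⁻¹) E_n(u + u⁻¹) = u^{n+1} - u^{-(n+1)}` (`u ≠ 0`).
[folklore] -/
theorem chebE_eval {K : Type*} [Field K] {u : K} (hu : u ≠ 0) :
    ∀ n, (u - u⁻¹) * (chebE K n).eval (u + u⁻¹) = u ^ (n + 1) - u⁻¹ ^ (n + 1)
  | 0 => by simp [chebE_zero]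
  | 1 => by simp only [chebE_one, eval_X]; ring
  | n + 2 => by
    have h1 := chebE_eval hu (n + 1)
    have h0 := chebE_eval hu n
    rw [chebE_add_two, eval_sub, eval_mul, eval_X, mul_sub, h0, ← mul_assoc, mul_comm (u - u⁻¹),
      mul_assoc, h1]
    have e : u * u⁻¹ = 1 := mul_inv_cancel₀ hu
    linear_combination (u ^ (n + 1) - u⁻¹ ^ (n + 1)) * e

/-- The real `spE` of `SymplecticCharacterPrincipal` is `chebE ℝ`. [folklore] -/
theorem spE_eq_chebE : ∀ n, spE n = chebE ℝ n
  | 0 => rfl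
  | 1 => rfl
  | n + 2 => by rw [spE_add_two, chebE_add_two, spE_eq_chebE (n + 1), spE_eq_chebE n]

end ChebE

/-! ### The alternants `det[E_{e_k - 1}(x_{u+i})]` in the variables `x_u, …, x_{u+L-1}` -/

section XAlternant

variable (K : Type*) [Field K]

/-- The entry `E_d(x_n)`: a Chebyshev polynomial at the variable `x_n`. [folklore] -/
noncomputable def xE (n d : ℕ) : MvPolynomial ℕ K :=
  Polynomial.aeval (MvPolynomial.X n : MvPolynomial ℕ K) (chebE K d)

/-- The matrix `[E_{e_k - 1}(x_{u+i})]_{i,k < L}`. [cite: IkhlefPonsaing2012, Def. 3.4] -/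
noncomputable def xAltMat (u L : ℕ) (e : ℕ → ℕ) : Matrix (Fin L) (Fin L) (MvPolynomial ℕ K) :=
  Matrix.of fun i k => xE K (u + i) (e k - 1)

/-- **The `x`-alternant** `A_e(x_u, …, x_{u+L-1}) = det[E_{e_k - 1}(x_{u+i})]`: IP12's alternant
`det[u_i^{e_k} - u_i^{-e_k}]` with the row factors `u_i - u_i⁻¹` removed, as a polynomial in
`x_i = u_i + u_i⁻¹`. [cite: IkhlefPonsaing2012, Def. 3.4] -/
noncomputable def xAlt (u L : ℕ) (e : ℕ → ℕ) : MvPolynomial ℕ K :=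
  (xAltMat K u L e).det

variable {K}

/-- An algebra homomorphism on an entry. [folklore] -/
theorem algHom_xE {A : Type*} [CommRing A] [Algebra K A] (φ : MvPolynomial ℕ K →ₐ[K] A) (n d : ℕ) :
    φ (xE K n d) = Polynomial.aeval (φ (MvPolynomial.X n)) (chebE K d) := by
  rw [xE, Polynomial.aeval_algHom_apply]

/-- An algebra endomorphism on the alternant. [folklore] -/
theorem algHom_xAlt (φ : MvPolynomial ℕ K →ₐ[K] MvPolynomial ℕ K) (u L : ℕ) (e : ℕ → ℕ) :
    φ (xAlt K u L e) = (Matrix.of fun i k : Fin L =>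
      Polynomial.aeval (φ (MvPolynomial.X (u + i))) (chebE K (e k - 1))).det := by
  rw [xAlt, show φ (xAltMat K u L e).det = φ.toRingHom (xAltMat K u L e).det from rfl, RingHom.map_det]
  congr 1
  ext i k
  simp only [RingHom.mapMatrix_apply, Matrix.map_apply, xAltMat, Matrix.of_apply, AlgHom.toRingHom_eq_coe,
    RingHom.coe_coe, algHom_xE]

/-- **Weyl's denominator in `x`-form is the Vandermonde**: `det[E_k(x_{u+i})] = ∏_{i<j} (x_{u+j} - x_{u+i})`.
[cite: FultonHarris1991, §24.2] -/
theorem xAlt_succ (u L : ℕ) :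
    xAlt K u L (· + 1) = ∏ i : Fin L, ∏ j ∈ Ioi i, (MvPolynomial.X (u + j) - MvPolynomial.X (u + i)) := by
  rw [← Matrix.det_vandermonde, xAlt,
    Matrix.det_eval_matrixOfPolynomials_eq_det_vandermonde (fun i : Fin L => (MvPolynomial.X (u + (i : ℕ)) : MvPolynomial ℕ K))
      (fun k : Fin L => (chebE K k).map MvPolynomial.C)
      (fun k => by rw [Polynomial.natDegree_map_eq_of_injective (MvPolynomial.C_injective ℕ K), (chebE_monic_natDegree k).2])
      (fun k => (chebE_monic_natDegree k).1.map _)]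
  congr 1
  ext i k
  simp only [xAltMat, Matrix.of_apply, xE, Nat.add_sub_cancel, Polynomial.eval_map, Polynomial.aeval_def,
    MvPolynomial.algebraMap_eq]

/-- The shear `x_b ↦ x_b - x_a` (`a ≠ b`) as an algebra automorphism (inverse `x_b ↦ x_b + x_a`).
[folklore] -/
noncomputable def shearAlg {a b : ℕ} (hab : a ≠ b) : MvPolynomial ℕ K ≃ₐ[K] MvPolynomial ℕ K := by
  classical
  refine AlgEquiv.ofAlgHom
    (MvPolynomial.aeval (Function.update (fun k => (MvPolynomial.X k : MvPolynomial ℕ K)) b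
      (MvPolynomial.X b - MvPolynomial.X a)))
    (MvPolynomial.aeval (Function.update (fun k => (MvPolynomial.X k : MvPolynomial ℕ K)) b
      (MvPolynomial.X b + MvPolynomial.X a)))
    ?_ ?_
  all_goals
    refine MvPolynomial.algHom_ext fun n => ?_
    simp only [AlgHom.coe_comp, Function.comp_apply, MvPolynomial.aeval_X, AlgHom.coe_id, id_eq]
    by_cases hn : n = b
    · subst hn
      simp only [Function.update_self, map_add, map_sub, MvPolynomial.aeval_X, Function.update_of_ne hab]
      ring
    · simp only [Function.update_of_ne hn, MvPolynomial.aeval_X]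

/-- The shear sends `x_b` to `x_b - x_a`. [folklore] -/
theorem shearAlg_X {a b : ℕ} (hab : a ≠ b) :
    shearAlg (K := K) hab (MvPolynomial.X b) = MvPolynomial.X b - MvPolynomial.X a := by
  classical
  simp [shearAlg]

/-- **`x_b - x_a` is prime** (`a ≠ b`). [folklore] -/
theorem prime_X_sub_X {a b : ℕ} (hab : a ≠ b) :
    Prime ((MvPolynomial.X b : MvPolynomial ℕ K) - MvPolynomial.X a) := by
  rw [← shearAlg_X (K := K) hab, MulEquiv.prime_iff]
  exact MvPolynomial.X_prime

/-- `x_i - x_j ≠ 0` for `i ≠ j`. [folklore] -/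
theorem X_sub_X_ne_zero {i j : ℕ} (hij : i ≠ j) :
    (MvPolynomial.X i : MvPolynomial ℕ K) - MvPolynomial.X j ≠ 0 := by
  intro h
  exact hij (MvPolynomial.X_injective (sub_eq_zero.1 h))

/-- **Factor theorem** (local copy): if `f(x_j ↦ g) = 0` then `x_j - g ∣ f`. [folklore] -/
private theorem X_sub_dvd_of_aeval_eq_zero' {j : ℕ} {g f : MvPolynomial ℕ K}
    (h : MvPolynomial.aeval (R := K)
      (Function.update (fun k => (MvPolynomial.X k : MvPolynomial ℕ K)) j g) f = 0) :
    (MvPolynomial.X j - g) ∣ f := by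
  classical
  set v : ℕ → MvPolynomial ℕ K := Function.update (fun k => (MvPolynomial.X k : MvPolynomial ℕ K)) j g with hv
  suffices hmain : ∀ f : MvPolynomial ℕ K, (MvPolynomial.X j - g) ∣ f - MvPolynomial.aeval (R := K) v f by
    have := hmain f
    rwa [h, sub_zero] at this
  intro f
  induction f using MvPolynomial.induction_on with
  | C a => simp
  | add p q hp hq =>
    have : p + q - MvPolynomial.aeval (R := K) v (p + q) =
        (p - MvPolynomial.aeval (R := K) v p) + (q - MvPolynomial.aeval (R := K) v q) := by
      rw [map_add]; ring
    rw [this]; exact dvd_add hp hq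
  | mul_X p k hp =>
    have hk : (MvPolynomial.X j - g) ∣ MvPolynomial.X k - MvPolynomial.aeval (R := K) v (MvPolynomial.X k) := by
      rw [MvPolynomial.aeval_X, hv, Function.update_apply]
      split_ifs with h
      · subst h; rfl
      · simp
    have : p * MvPolynomial.X k - MvPolynomial.aeval (R := K) v (p * MvPolynomial.X k) =
        (p - MvPolynomial.aeval (R := K) v p) * MvPolynomial.X k +
          MvPolynomial.aeval (R := K) v p * (MvPolynomial.X k - MvPolynomial.aeval (R := K) v (MvPolynomial.X k)) := by
      rw [map_mul]; ring
    rw [this]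
    exact dvd_add (dvd_mul_of_dvd_left hp _) (dvd_mul_of_dvd_right hk _)

/-- **Equal rows**: `x_{u+j} - x_{u+i}` divides every `x`-alternant (`i ≠ j`). [folklore] -/
theorem X_sub_X_dvd_xAlt (u L : ℕ) (e : ℕ → ℕ) {i j : Fin L} (hij : i ≠ j) :
    (MvPolynomial.X (u + j) - MvPolynomial.X (u + i) : MvPolynomial ℕ K) ∣ xAlt K u L e := by
  classical
  apply X_sub_dvd_of_aeval_eq_zero'
  rw [algHom_xAlt]
  refine Matrix.det_zero_of_row_eq hij ?_
  ext k
  simp only [Matrix.of_apply, MvPolynomial.aeval_X]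
  have hne : (u + (i : ℕ)) ≠ u + (j : ℕ) := fun h => hij (Fin.ext (by omega))
  rw [Function.update_of_ne hne, Function.update_self]

/-- The double product over `i < j` as a product over the set of pairs. [folklore] -/
theorem prod_Ioi_eq_prod_filter {M : Type*} [CommMonoid M] (L : ℕ) (f : Fin L → Fin L → M) :
    ∏ i : Fin L, ∏ j ∈ Ioi i, f i j =
      ∏ p ∈ (Finset.univ : Finset (Fin L × Fin L)).filter (fun p => p.1 < p.2), f p.1 p.2 := by
  rw [Finset.prod_filter, ← Finset.univ_product_univ, Finset.prod_product]
  refine Finset.prod_congr rfl fun i _ => ?_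
  rw [← Finset.prod_filter, Finset.filter_lt_eq_Ioi]

/-- Distinct pairs give non-associated (indeed relatively prime) linear forms. [folklore] -/
theorem isRelPrime_X_sub_X (u : ℕ) {L : ℕ} {p p' : Fin L × Fin L} (hp : p.1 < p.2) (hp' : p'.1 < p'.2)
    (hne : p ≠ p') :
    IsRelPrime ((MvPolynomial.X (u + p.2) : MvPolynomial ℕ K) - MvPolynomial.X (u + p.1))
      ((MvPolynomial.X (u + p'.2) : MvPolynomial ℕ K) - MvPolynomial.X (u + p'.1)) := by
  classical
  have hab : (u + (p.1 : ℕ)) ≠ u + (p.2 : ℕ) := by have := Fin.lt_def.1 hp; omega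
  rw [(prime_X_sub_X (K := K) hab).irreducible.isRelPrime_iff_not_dvd]
  rintro ⟨r, hr⟩
  -- substitute `x_{u+p.2} ↦ x_{u+p.1}`
  set φ := MvPolynomial.aeval (R := K)
    (Function.update (fun k => (MvPolynomial.X k : MvPolynomial ℕ K)) (u + p.2) (MvPolynomial.X (u + p.1))) with hφ
  have hkill : φ (MvPolynomial.X (u + p.2) - MvPolynomial.X (u + p.1)) = 0 := by
    rw [map_sub, hφ, MvPolynomial.aeval_X, MvPolynomial.aeval_X, Function.update_self,
      Function.update_of_ne hab, sub_self]
  have himg := congrArg φ hr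
  rw [map_mul, hkill, zero_mul, map_sub, hφ, MvPolynomial.aeval_X, MvPolynomial.aeval_X] at himg
  -- case analysis on the position of `p'` relative to `p.2`
  have h1 : (p'.1 : ℕ) < p'.2 := Fin.lt_def.1 hp'
  have h0 : (p.1 : ℕ) < p.2 := Fin.lt_def.1 hp
  by_cases h2 : p'.2 = p.2
  · have h21 : (u + (p'.1 : ℕ)) ≠ u + (p.2 : ℕ) := by rw [← h2]; omega
    rw [h2, Function.update_self, Function.update_of_ne h21] at himg
    refine X_sub_X_ne_zero (K := K) (i := u + p.1) (j := u + p'.1) (fun h => hne ?_) himg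
    exact Prod.ext (Fin.ext (by omega)) (h2 ▸ rfl) |>.symm
  · have h22 : (u + (p'.2 : ℕ)) ≠ u + (p.2 : ℕ) := fun h => h2 (Fin.ext (by omega))
    rw [Function.update_of_ne h22] at himg
    by_cases h3 : (u + (p'.1 : ℕ)) = u + (p.2 : ℕ)
    · rw [h3, Function.update_self] at himg
      exact X_sub_X_ne_zero (K := K) (i := u + p'.2) (j := u + p.1) (by omega) himg
    · rw [Function.update_of_ne h3] at himg
      exact X_sub_X_ne_zero (K := K) (i := u + p'.2) (j := u + p'.1) (by omega) himg

/-- **The Vandermonde divides every `x`-alternant.** [cite: FultonHarris1991, §24.2 (Weyl character formula, type C)] -/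
theorem xAlt_succ_dvd_xAlt (u L : ℕ) (e : ℕ → ℕ) : xAlt K u L (· + 1) ∣ xAlt K u L e := by
  classical
  rw [xAlt_succ, prod_Ioi_eq_prod_filter]
  refine Finset.prod_dvd_of_isRelPrime (fun p hp p' hp' hpp' => ?_) (fun p hp => ?_)
  · exact isRelPrime_X_sub_X u (Finset.mem_filter.1 hp).2 (Finset.mem_filter.1 hp').2 hpp'
  · exact X_sub_X_dvd_xAlt u L e (ne_of_lt (Finset.mem_filter.1 hp).2)

/-- The Vandermonde in the `x`'s is not zero. [folklore] -/
theorem xAlt_succ_ne_zero (u L : ℕ) : xAlt K u L (· + 1) ≠ 0 := by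
  rw [xAlt_succ, prod_Ioi_eq_prod_filter]
  exact Finset.prod_ne_zero_iff.2 fun p hp =>
    X_sub_X_ne_zero (K := K) (by have := Fin.lt_def.1 (Finset.mem_filter.1 hp).2; omega)

variable (K) in
/-- **IP12's symplectic character in the variables `x_i = u_i + u_i⁻¹`**: the polynomial
`S_L(x_u, …, x_{u+L-1})` with `det[E_{μ_k-1}(x_{u+i})] = det[E_k(x_{u+i})] · S_L`, `μ_k = ipMu k`
(Weyl's character formula: the bialternant of Def. 3.4 is `S_L(u_1 + u_1⁻¹, …, u_L + u_L⁻¹)`,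
`spChar_eq_eval_spS`). [cite: IkhlefPonsaing2012, Def. 3.4; FultonHarris1991, §24.2] -/
noncomputable def spS (u L : ℕ) : MvPolynomial ℕ K :=
  (xAlt_succ_dvd_xAlt (K := K) u L (fun k => ipMu k)).choose

/-- **The defining identity** `A_μ = V · S_L`. [cite: IkhlefPonsaing2012, Def. 3.4] -/
theorem xAlt_ipMu_eq (u L : ℕ) : xAlt K u L (fun k => ipMu k) = xAlt K u L (· + 1) * spS K u L :=
  (xAlt_succ_dvd_xAlt (K := K) u L (fun k => ipMu k)).choose_spec

/-- `S_L` is characterised by the identity. [folklore] -/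
theorem eq_spS_of_mul_eq {u L : ℕ} {c : MvPolynomial ℕ K} (h : xAlt K u L (fun k => ipMu k) = xAlt K u L (· + 1) * c) :
    c = spS K u L :=
  mul_left_cancel₀ (xAlt_succ_ne_zero u L) (h.symm.trans (xAlt_ipMu_eq u L))

/-! ### Change of field -/

/-- An entry under a change of scalars. [folklore] -/
theorem map_xE {K' : Type*} [Field K'] (f : K →+* K') (n d : ℕ) : MvPolynomial.map f (xE K n d) = xE K' n d := by
  rw [xE, xE, Polynomial.aeval_def, Polynomial.aeval_def, MvPolynomial.algebraMap_eq, MvPolynomial.algebraMap_eq,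
    Polynomial.hom_eval₂, MvPolynomial.map_X, ← chebE_map f d, Polynomial.eval₂_map]
  congr 1
  ext a
  simp

/-- The alternant under a change of scalars. [folklore] -/
theorem map_xAlt {K' : Type*} [Field K'] (f : K →+* K') (u L : ℕ) (e : ℕ → ℕ) :
    MvPolynomial.map f (xAlt K u L e) = xAlt K' u L e := by
  rw [xAlt, xAlt, RingHom.map_det]
  congr 1
  ext i k
  simp only [RingHom.mapMatrix_apply, Matrix.map_apply, xAltMat, Matrix.of_apply, map_xE]

/-- **`S_L` under a change of scalars.** [folklore] -/
theorem map_spS {K' : Type*} [Field K'] (f : K →+* K') (u L : ℕ) : MvPolynomial.map f (spS K u L) = spS K' u L := by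
  apply eq_spS_of_mul_eq
  rw [← map_xAlt f, ← map_xAlt f u L (· + 1), ← map_mul, ← xAlt_ipMu_eq]

/-! ### Symmetry -/

/-- Transpositions commute with the window embedding `i ↦ u + i`. [folklore] -/
theorem swap_add_apply (u : ℕ) {L : ℕ} (i j i' : Fin L) :
    Equiv.swap (u + (i : ℕ)) (u + (j : ℕ)) (u + (i' : ℕ)) = u + ((Equiv.swap i j i' : Fin L) : ℕ) := by
  rw [Equiv.swap_apply_def, Equiv.swap_apply_def]
  by_cases h1 : i' = i
  · subst h1; simp
  · have h1' : (u + (i' : ℕ)) ≠ u + (i : ℕ) := fun h => h1 (Fin.ext (by omega))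
    by_cases h2 : i' = j
    · subst h2; simp [h1]
    · have h2' : (u + (i' : ℕ)) ≠ u + (j : ℕ) := fun h => h2 (Fin.ext (by omega))
      rw [if_neg h1', if_neg h2', if_neg h1, if_neg h2]

/-- A transposition of two of the variables changes the sign of the alternant. [folklore] -/
theorem rename_swap_xAlt (u L : ℕ) (e : ℕ → ℕ) {i j : Fin L} (hij : i ≠ j) :
    MvPolynomial.rename (Equiv.swap (u + (i : ℕ)) (u + (j : ℕ))) (xAlt K u L e) = -xAlt K u L e := by
  classical
  rw [algHom_xAlt]
  have hmat : (Matrix.of fun i' k : Fin L => Polynomial.aeval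
      (MvPolynomial.rename (Equiv.swap (u + (i : ℕ)) (u + (j : ℕ))) (MvPolynomial.X (u + (i' : ℕ)) : MvPolynomial ℕ K))
        (chebE K (e k - 1))) = (xAltMat K u L e).submatrix (Equiv.swap i j) id := by
    ext i' k
    simp only [Matrix.of_apply, Matrix.submatrix_apply, id_eq, xAltMat, MvPolynomial.rename_X, xE, swap_add_apply]
  rw [hmat, Matrix.det_permute, Equiv.Perm.sign_swap hij, xAlt]
  simp

/-- **`S_L` is symmetric** in its variables. [cite: IkhlefPonsaing2012, Def. 3.4] -/
theorem rename_swap_spS (u L : ℕ) {i j : Fin L} (hij : i ≠ j) :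
    MvPolynomial.rename (Equiv.swap (u + (i : ℕ)) (u + (j : ℕ))) (spS K u L) = spS K u L := by
  apply eq_spS_of_mul_eq
  have h := congrArg (MvPolynomial.rename (Equiv.swap (u + (i : ℕ)) (u + (j : ℕ)))) (xAlt_ipMu_eq (K := K) u L)
  rw [map_mul, rename_swap_xAlt u L _ hij, rename_swap_xAlt u L _ hij, neg_mul, neg_inj] at h
  exact h

/-- A transposition outside the window fixes the alternant's variables… and swapping two window
variables by their indices in `ℕ`. [folklore] -/
theorem rename_swap_spS' (u L : ℕ) {a b : ℕ} (ha : u ≤ a) (haL : a < u + L) (hb : u ≤ b) (hbL : b < u + L) :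
    MvPolynomial.rename (Equiv.swap a b) (spS K u L) = spS K u L := by
  by_cases hab : a = b
  · subst hab; rw [Equiv.swap_self]; exact MvPolynomial.rename_id_apply _
  · have h := rename_swap_spS (K := K) u L (i := ⟨a - u, by omega⟩) (j := ⟨b - u, by omega⟩)
      (fun h => hab (by have := Fin.mk.inj_iff.1 h; omega))
    simp only at h
    rwa [show u + (a - u) = a by omega, show u + (b - u) = b by omega] at h

/-! ### Evaluation: the bialternant of Def. 3.4 is `S_L(u + u⁻¹)` -/

open Filter Topology

/-- Evaluating an entry. [folklore] -/
theorem eval_xE (x : ℕ → K) (n d : ℕ) : MvPolynomial.eval x (xE K n d) = (chebE K d).eval (x n) := by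
  have h := algHom_xE (MvPolynomial.aeval (R := K) x) n d
  rw [MvPolynomial.aeval_X, Polynomial.coe_aeval_eq_eval] at h
  rw [← h]
  rfl

/-- Evaluating the alternant. [folklore] -/
theorem eval_xAlt (x : ℕ → K) (u L : ℕ) (e : ℕ → ℕ) :
    MvPolynomial.eval x (xAlt K u L e) = (Matrix.of fun i k : Fin L => (chebE K (e k - 1)).eval (x (u + i))).det := by
  rw [xAlt, RingHom.map_det]
  congr 1
  ext i k
  simp only [RingHom.mapMatrix_apply, Matrix.map_apply, xAltMat, Matrix.of_apply, eval_xE]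

/-- **Row factorisation of IP12's alternant**: for exponents `e ≥ 1`,
`det[u_i^{e_k} - u_i^{-e_k}] = ∏_i (u_i - u_i⁻¹) · det[E_{e_k-1}(u_i + u_i⁻¹)]`. [folklore] -/
theorem spAlt_eq_prod_mul_det (L : ℕ) {e : ℕ → ℕ} (he : ∀ k, 1 ≤ e k) (u : Fin L → ℝ) (hu : ∀ i, u i ≠ 0) :
    spAlt L e u = (∏ i, (u i - (u i)⁻¹)) *
      (Matrix.of fun i k : Fin L => (chebE ℝ (e k - 1)).eval (u i + (u i)⁻¹)).det := by
  unfold spAlt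
  rw [← Matrix.det_mul_column]
  congr 1
  ext i k
  simp only [Matrix.of_apply]
  rw [chebE_eval (hu i), Nat.sub_add_cancel (he k)]

/-- The point `x_{u+i} = u_i + u_i⁻¹` of the window (zero elsewhere). [folklore] -/
noncomputable def xPt (u L : ℕ) (v : Fin L → ℝ) : ℕ → ℝ :=
  fun n => if h : u ≤ n ∧ n < u + L then v ⟨n - u, by omega⟩ + (v ⟨n - u, by omega⟩)⁻¹ else 0

/-- The point on the window. [folklore] -/
theorem xPt_add (u L : ℕ) (v : Fin L → ℝ) (i : Fin L) : xPt u L v (u + i) = v i + (v i)⁻¹ := by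
  unfold xPt
  rw [dif_pos ⟨by omega, by omega⟩]
  have : (⟨u + (i : ℕ) - u, by omega⟩ : Fin L) = i := Fin.ext (by simp)
  rw [this]

/-- **Weyl's character formula for the bialternant of Def. 3.4**: wherever the Weyl denominator does
not vanish, `χ_L(u) = S_L(u_1 + u_1⁻¹, …, u_L + u_L⁻¹)`. [cite: IkhlefPonsaing2012, Def. 3.4; FultonHarris1991, §24.2] -/
theorem spChar_eq_eval_spS (u L : ℕ) (v : Fin L → ℝ) (hv : ∀ i, v i ≠ 0) (hden : spAlt L (· + 1) v ≠ 0) :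
    spChar L v = MvPolynomial.eval (xPt u L v) (spS ℝ u L) := by
  have hμ : ∀ k, 1 ≤ ipMu k := fun k => by unfold ipMu; omega
  have hA := spAlt_eq_prod_mul_det L hμ v hv
  have hV := spAlt_eq_prod_mul_det L (e := (· + 1)) (fun k => by omega) v hv
  -- the two determinants are evaluations of the `x`-alternants
  have hA' : (Matrix.of fun i k : Fin L => (chebE ℝ (ipMu k - 1)).eval (v i + (v i)⁻¹)).det =
      MvPolynomial.eval (xPt u L v) (xAlt ℝ u L fun k => ipMu k) := by
    rw [eval_xAlt]; congr 1; ext i k; simp only [Matrix.of_apply, xPt_add]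
  have hV' : (Matrix.of fun i k : Fin L => (chebE ℝ ((k : ℕ) + 1 - 1)).eval (v i + (v i)⁻¹)).det =
      MvPolynomial.eval (xPt u L v) (xAlt ℝ u L (· + 1)) := by
    rw [eval_xAlt]; congr 1; ext i k; simp only [Matrix.of_apply, xPt_add]
  rw [hV'] at hV
  rw [hA'] at hA
  have hP : (∏ i, (v i - (v i)⁻¹)) ≠ 0 := fun h => hden (by rw [hV, h, zero_mul])
  have hVne : MvPolynomial.eval (xPt u L v) (xAlt ℝ u L (· + 1)) ≠ 0 := fun h => hden (by rw [hV, h, mul_zero])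
  unfold spChar
  rw [hA, hV, xAlt_ipMu_eq, map_mul, mul_div_mul_left _ _ hP, mul_div_cancel_left₀ _ hVne]

/-- The Weyl denominator does not vanish at the principal specialisation `u_i = q^{i+1}`, `q > 0`,
`q ≠ 1`. [folklore] -/
theorem spAlt_succ_principal_ne_zero (L : ℕ) {q : ℝ} (hq : 0 < q) (hq1 : q ≠ 1) :
    spAlt L (· + 1) (fun i : Fin L => q ^ ((i : ℕ) + 1)) ≠ 0 := by
  have hq0 : q ≠ 0 := hq.ne'
  have hpow : ∀ n : ℕ, q ^ n ≠ 0 := fun n => pow_ne_zero n hq0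
  have hinj := pow_right_injective₀ hq hq1
  rw [spAlt_succ_eq _ _ fun i => hpow _]
  refine mul_ne_zero (Finset.prod_ne_zero_iff.2 fun i _ => ?_)
    (Finset.prod_ne_zero_iff.2 fun i _ => Finset.prod_ne_zero_iff.2 fun j hj => ?_)
  · -- `u - u⁻¹ ≠ 0` since `u² ≠ 1`
    intro h
    have h2 : q ^ ((i : ℕ) + 1) * q ^ ((i : ℕ) + 1) = 1 := by
      have := sub_eq_zero.1 h
      field_simp at this
      linear_combination this
    rw [← pow_add, ← pow_zero q] at h2
    have := hinj h2
    omega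
  · have hij : (i : ℕ) < j := Fin.lt_def.1 (Finset.mem_Ioi.1 hj)
    intro h
    have key : (q ^ ((j : ℕ) + 1) - q ^ ((i : ℕ) + 1)) * (q ^ ((i : ℕ) + 1) * q ^ ((j : ℕ) + 1) - 1) =
        (q ^ ((j : ℕ) + 1) + (q ^ ((j : ℕ) + 1))⁻¹ - (q ^ ((i : ℕ) + 1) + (q ^ ((i : ℕ) + 1))⁻¹)) *
          (q ^ ((i : ℕ) + 1) * q ^ ((j : ℕ) + 1)) := by
      have hi0 := hpow ((i : ℕ) + 1)
      have hj0 := hpow ((j : ℕ) + 1)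
      field_simp
      ring
    rw [h, zero_mul] at key
    rcases mul_eq_zero.1 key with h1 | h1
    · have := hinj (sub_eq_zero.1 h1)
      omega
    · rw [← pow_add, sub_eq_zero, ← pow_zero q] at h1
      have := hinj h1
      omega

/-- **The value at `x = 2`, i.e. the homogeneous value `χ_L(1, …, 1) = ipSpDim L`** (Weyl's dimension
formula, through the principal specialisation `tendsto_spChar_principal`). [cite: IkhlefPonsaing2012, Prop. 4.7; FultonHarris1991, §24.2] -/
theorem eval_two_spS_real (u L : ℕ) :
    MvPolynomial.eval (xPt u L fun _ => (1 : ℝ)) (spS ℝ u L) = ((ipSpDim L : ℚ) : ℝ) := by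
  -- the path `q ↦ x(q)` and continuity of the evaluation along it
  set path : ℝ → ℕ → ℝ := fun q => xPt u L fun i : Fin L => q ^ ((i : ℕ) + 1) with hpath
  have hcont : ContinuousAt (fun q => MvPolynomial.eval (path q) (spS ℝ u L)) 1 := by
    refine (MvPolynomial.continuous_eval (spS ℝ u L)).continuousAt.comp ?_
    refine continuousAt_pi.2 fun n => ?_
    simp only [hpath, xPt]
    split_ifs with h
    · have hc : ContinuousAt (fun q : ℝ => q ^ ((n - u) + 1)) 1 := (continuous_pow _).continuousAt
      exact hc.add (hc.inv₀ (by simp))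
    · exact continuousAt_const
  have hlim1 : Tendsto (fun q => MvPolynomial.eval (path q) (spS ℝ u L)) (𝓝[≠] 1)
      (𝓝 (MvPolynomial.eval (path 1) (spS ℝ u L))) := tendsto_nhdsWithin_of_tendsto_nhds hcont.tendsto
  have hpath1 : path 1 = xPt u L fun _ => (1 : ℝ) := by
    simp only [hpath, one_pow]
  rw [hpath1] at hlim1
  -- along `q ≠ 1`, `q > 0` the evaluation is the character
  have hpos : ∀ᶠ q : ℝ in 𝓝[≠] 1, 0 < q := mem_nhdsWithin_of_mem_nhds (lt_mem_nhds (by norm_num : (0 : ℝ) < 1))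
  have hne : ∀ᶠ q : ℝ in 𝓝[≠] 1, q ≠ 1 := self_mem_nhdsWithin
  have heq : (fun q : ℝ => spChar L (fun i : Fin L => q ^ ((i : ℕ) + 1))) =ᶠ[𝓝[≠] 1]
      fun q => MvPolynomial.eval (path q) (spS ℝ u L) := by
    filter_upwards [hpos, hne] with q hq hq1
    exact spChar_eq_eval_spS u L _ (fun i => pow_ne_zero _ hq.ne') (spAlt_succ_principal_ne_zero L hq hq1)
  exact tendsto_nhds_unique (hlim1.congr' heq.symm) (tendsto_spChar_principal L)

/-- **The homogeneous value over any field receiving `ℝ`** (used with `K = ℂ`): `S_L(2, …, 2) = ipSpDim L`.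
[cite: IkhlefPonsaing2012, Prop. 4.7] -/
theorem eval_two_spS (f : ℝ →+* K) (u L : ℕ) :
    MvPolynomial.eval (f ∘ xPt u L (fun _ => (1 : ℝ))) (spS K u L) = ((ipSpDim L : ℚ) : K) := by
  rw [← map_spS f u L, MvPolynomial.eval_map, ← MvPolynomial.coe_eval₂Hom]
  have h := MvPolynomial.eval₂_comp_left f (RingHom.id ℝ) (xPt u L (fun _ => (1 : ℝ))) (spS ℝ u L)
  rw [RingHom.comp_id] at h
  rw [MvPolynomial.coe_eval₂Hom, ← h]
  have h2 : MvPolynomial.eval₂ (RingHom.id ℝ) (xPt u L (fun _ => (1 : ℝ))) (spS ℝ u L) =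
      MvPolynomial.eval (xPt u L fun _ => (1 : ℝ)) (spS ℝ u L) := rfl
  rw [h2, eval_two_spS_real, map_ratCast]

/-! ### Non-vanishing -/

/-- `μ` is strictly increasing. [folklore] -/
theorem ipMu_lt_ipMu {k l : ℕ} (h : k < l) : ipMu k < ipMu l := by
  unfold ipMu; omega

/-- Weyl's dimension product is positive. [folklore] -/
theorem ipSpDim_pos (L : ℕ) : 0 < ipSpDim L := by
  unfold ipSpDim
  refine Finset.prod_pos fun l _ => ?_
  unfold ipSpStep
  refine mul_pos (by unfold ipMu; positivity) (Finset.prod_pos fun k hk => ?_)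
  have hkl : k < l := Finset.mem_range.1 hk
  have h1 : (ipMu k : ℚ) < ipMu l := by exact_mod_cast ipMu_lt_ipMu hkl
  have h2 : ((k : ℚ) + 1) < (l : ℚ) + 1 := by exact_mod_cast Nat.succ_lt_succ hkl
  have h0 : (0 : ℚ) ≤ ipMu k := by positivity
  have h0' : (0 : ℚ) ≤ (k : ℚ) + 1 := by positivity
  apply div_pos <;> nlinarith

/-- **`S_L ≠ 0`** over a field of characteristic zero. [cite: IkhlefPonsaing2012, Def. 3.4] -/
theorem spS_ne_zero [CharZero K] (u L : ℕ) : spS K u L ≠ 0 := by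
  have hR : spS ℝ u L ≠ 0 := fun h => by
    have := eval_two_spS_real u L
    rw [h, map_zero] at this
    have hpos := ipSpDim_pos L
    have : ((ipSpDim L : ℚ) : ℝ) = 0 := this.symm
    exact hpos.ne' (by exact_mod_cast this)
  have hQ : spS ℚ u L ≠ 0 := fun h => hR (by rw [← map_spS (Rat.castHom ℝ) u L, h, map_zero])
  intro h
  apply hQ
  apply MvPolynomial.map_injective (algebraMap ℚ K) (algebraMap ℚ K).injective
  rw [map_spS, h, map_zero]

/-- Hence the numerator alternant is not zero either. [folklore] -/
theorem xAlt_ipMu_ne_zero [CharZero K] (u L : ℕ) : xAlt K u L (fun k => ipMu k) ≠ 0 := by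
  rw [xAlt_ipMu_eq]
  exact mul_ne_zero (xAlt_succ_ne_zero u L) (spS_ne_zero u L)

/-! ### Variables and degrees -/

/-- `deg_{x_n} E_d(x_n) ≤ d`. [folklore] -/
theorem degreeOf_xE_le (n d : ℕ) : (xE K n d).degreeOf n ≤ d := by
  classical
  rw [xE, Polynomial.aeval_eq_sum_range, (chebE_monic_natDegree (R := K) d).2]
  refine (MvPolynomial.degreeOf_sum_le _ _ _).trans (Finset.sup_le fun i hi => ?_)
  have hi' : i ≤ d := by have := Finset.mem_range.1 hi; omega
  rw [MvPolynomial.smul_eq_C_mul]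
  refine (MvPolynomial.degreeOf_C_mul_le _ _ _).trans ((MvPolynomial.degreeOf_pow_le _ _ _).trans ?_)
  rw [MvPolynomial.degreeOf_X, if_pos rfl, mul_one]
  exact hi'

/-- `E_d(x_n)` does not involve the other variables. [folklore] -/
theorem degreeOf_xE_of_ne {n n' : ℕ} (h : n' ≠ n) (d : ℕ) : (xE K n d).degreeOf n' = 0 := by
  classical
  apply Nat.eq_zero_of_le_zero
  rw [xE, Polynomial.aeval_eq_sum_range]
  refine (MvPolynomial.degreeOf_sum_le _ _ _).trans (Finset.sup_le fun i _ => ?_)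
  rw [MvPolynomial.smul_eq_C_mul]
  refine (MvPolynomial.degreeOf_C_mul_le _ _ _).trans ((MvPolynomial.degreeOf_pow_le _ _ _).trans ?_)
  rw [MvPolynomial.degreeOf_X, if_neg h, mul_zero]

/-- Degree of a determinant in a variable occurring in one row only. [folklore] -/
theorem degreeOf_det_le {L : ℕ} (M : Matrix (Fin L) (Fin L) (MvPolynomial ℕ K)) (n : ℕ) (i₀ : Fin L) (d : ℕ)
    (h : ∀ i k, (M i k).degreeOf n ≤ if i = i₀ then d else 0) : M.det.degreeOf n ≤ d := by
  classical
  rw [Matrix.det_apply]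
  refine (MvPolynomial.degreeOf_sum_le _ _ _).trans (Finset.sup_le fun σ _ => ?_)
  have hsmul : ∀ f : MvPolynomial ℕ K, (Equiv.Perm.sign σ • f).degreeOf n = f.degreeOf n := fun f => by
    rcases Int.units_eq_one_or (Equiv.Perm.sign σ) with hs | hs
    · rw [hs, one_smul]
    · rw [hs, Units.neg_smul, one_smul, MvPolynomial.degreeOf_neg]
  rw [hsmul]
  refine (MvPolynomial.degreeOf_prod_le _ _ _).trans ?_
  calc ∑ i, (M (σ i) i).degreeOf n ≤ ∑ i, (if σ i = i₀ then d else 0) := Finset.sum_le_sum fun i _ => h _ _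
    _ = d := by
      rw [Finset.sum_ite, Finset.sum_const_zero, add_zero, Finset.sum_const, smul_eq_mul]
      have : (Finset.univ.filter fun i => σ i = i₀) = {σ.symm i₀} := by
        ext i; simp [Equiv.eq_symm_apply, eq_comm]
      rw [this, Finset.card_singleton, one_mul]

/-- A determinant not involving a variable at all. [folklore] -/
theorem degreeOf_det_eq_zero {L : ℕ} (M : Matrix (Fin L) (Fin L) (MvPolynomial ℕ K)) (n : ℕ)
    (h : ∀ i k, (M i k).degreeOf n = 0) : M.det.degreeOf n = 0 := by
  classical
  apply Nat.eq_zero_of_le_zero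
  rw [Matrix.det_apply]
  refine (MvPolynomial.degreeOf_sum_le _ _ _).trans (Finset.sup_le fun σ _ => ?_)
  have hsmul : ∀ f : MvPolynomial ℕ K, (Equiv.Perm.sign σ • f).degreeOf n = f.degreeOf n := fun f => by
    rcases Int.units_eq_one_or (Equiv.Perm.sign σ) with hs | hs
    · rw [hs, one_smul]
    · rw [hs, Units.neg_smul, one_smul, MvPolynomial.degreeOf_neg]
  rw [hsmul]
  refine (MvPolynomial.degreeOf_prod_le _ _ _).trans ?_
  rw [Finset.sum_eq_zero fun i _ => h _ _]

/-- **`deg_{x_{u+i}} A_e ≤ max_k (e_k - 1)`.** [folklore] -/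
theorem degreeOf_xAlt_le (u L : ℕ) (e : ℕ → ℕ) (i₀ : Fin L) (d : ℕ) (hd : ∀ k < L, e k - 1 ≤ d) :
    (xAlt K u L e).degreeOf (u + i₀) ≤ d := by
  refine degreeOf_det_le _ _ i₀ d fun i k => ?_
  simp only [xAltMat, Matrix.of_apply]
  split_ifs with h
  · subst h; exact (degreeOf_xE_le _ _).trans (hd k k.2)
  · rw [degreeOf_xE_of_ne (fun h' => h (Fin.ext (by omega))) _]

/-- The alternant only involves the window variables. [folklore] -/
theorem degreeOf_xAlt_eq_zero (u L : ℕ) (e : ℕ → ℕ) {n : ℕ} (hn : n < u ∨ u + L ≤ n) :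
    (xAlt K u L e).degreeOf n = 0 := by
  refine degreeOf_det_eq_zero _ _ fun i k => ?_
  simp only [xAltMat, Matrix.of_apply]
  exact degreeOf_xE_of_ne (by rcases hn with hn | hn <;> omega) _

/-- **`S_L` only involves the window variables.** [folklore] -/
theorem degreeOf_spS_eq_zero [CharZero K] (u L : ℕ) {n : ℕ} (hn : n < u ∨ u + L ≤ n) :
    (spS K u L).degreeOf n = 0 := by
  have h := congrArg (MvPolynomial.degreeOf n) (xAlt_ipMu_eq (K := K) u L)
  rw [MvPolynomial.degreeOf_mul_eq (xAlt_succ_ne_zero u L) (spS_ne_zero u L), degreeOf_xAlt_eq_zero u L _ hn,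
    degreeOf_xAlt_eq_zero u L _ hn] at h
  omega

/-! ### Laplace expansion along the first variable -/

/-- The minor complementary to the first row and the last column is the alternant of the next window.
[folklore] -/
theorem xAltMat_submatrix_last (u L : ℕ) (e : ℕ → ℕ) :
    (xAltMat K u (L + 1) e).submatrix Fin.succ (Fin.last L).succAbove = xAltMat K (u + 1) L e := by
  ext i k
  simp only [Matrix.submatrix_apply, xAltMat, Matrix.of_apply, Fin.succAbove_last, Fin.val_castSucc, Fin.val_succ]
  rw [show u + ((i : ℕ) + 1) = u + 1 + (i : ℕ) by omega]

/-- **Laplace expansion of the alternant along its first row** (the variable `x_u`). [folklore] -/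
theorem xAlt_succ_eq_sum (u L : ℕ) (e : ℕ → ℕ) :
    xAlt K u (L + 1) e = ∑ k : Fin (L + 1), (-1) ^ (k : ℕ) * xE K u (e k - 1) *
      ((xAltMat K u (L + 1) e).submatrix Fin.succ k.succAbove).det := by
  rw [xAlt, Matrix.det_succ_row_zero]
  refine Finset.sum_congr rfl fun k _ => ?_
  simp only [xAltMat, Matrix.of_apply, Fin.val_zero, add_zero]

/-- The minors of the first row do not involve `x_u`. [folklore] -/
theorem degreeOf_minor_eq_zero (u L : ℕ) (e : ℕ → ℕ) (k : Fin (L + 1)) :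
    (((xAltMat K u (L + 1) e).submatrix Fin.succ k.succAbove).det).degreeOf u = 0 := by
  refine degreeOf_det_eq_zero _ _ fun i k' => ?_
  simp only [Matrix.submatrix_apply, xAltMat, Matrix.of_apply, Fin.val_succ]
  exact degreeOf_xE_of_ne (by omega) _

end XAlternant

end Literature.Combinatorics.Enumerative
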